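import Mathlib
import Summits.ValiantsHypothesis.ValiantsHypothesis.Theses.AlgebraicKWGames
import Summits.ValiantsHypothesis.ValiantsHypothesis.Theorems.AlgebraicKWGamesBoundedAlternationLowerBound
import Summits.ValiantsHypothesis.ValiantsHypothesis.Theorems.AlgebraicKWGamesHistoryAlternationCount

/-!
# The history-dependent bounded-alternation rung of `KWPerLowerBound` — proved

Support theorems for the crux `stmt-ValiantsHypothesis-10298`
(`Summit.ValiantsHypothesis.ValiantsHypothesis.Theses.AlgebraicKWGames.KWPerLowerBound`, route
`AlgebraicKWGames`), filed `--supports`; the crux itself is NOT proved.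

`KWPerLowerBound` (X) quantifies over zero-test algebraic protocols whose speaker in round `t` is an
arbitrary function `owner t (z↾t)` of the public zero pattern of the earlier messages.  The closed
calibration crux `BoundedAlternationLowerBound` (item 10299, `…Theorems.AlgebraicKWGamesBoundedAlternationLowerBound`)
only covers OBLIVIOUS schedules (a monotone block index `blk : ℕ → ℕ`, `≤ Δ`).  Here the same
transcendence-degree adversary with its lexicographic rank potential is run in the model of X itself:

* `kwSearch_lowerBound_of_altBound` — for EVERY polynomial `f` in the `n × n` cells that depends on
  every cell (pointwise) and every depth `T` and alternation budget `Δ` with `(2T+1)^(Δ+2) + 1 ≤ n²`,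
  there is no protocol `(owner, msg, out)` for the KW game of `f` (on `f a ≠ f b`, output a cell where
  `a` and `b` differ) whose speaker alternates at most `Δ` times along every zero pattern.  The
  adversary never uses more of `f` than its dependence on every cell: the bound is one for SEARCH with
  few alternations, not for the permanent.
* `kwPer_lowerBound_of_altBound` — the permanent instance in the exact shape of X with the alternation
  hypothesis added: for all `Δ, c` there is `n ≥ 2` (namely `n = 2^(2^(2Δ+c+6))`) such that no protocol
  of depth `c·(⌊log₂ n⌋+1)²` with at most `Δ` alternations along every zero pattern solves the KW game
  of `per_n`.
* `kwDet_lowerBound_of_altBound` — the same for `det_n` (the route's remark "expected to hold for det too").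
* the sandwich in the kernel: `kwPerLowerBound_implies_altBound` (X implies the new statement, by
  dropping the alternation hypothesis) and `oblivious_of_altBound` (the new statement implies the
  oblivious one of item 10299, pointwise in `n` and `T`) — so the new theorem sits between the closed
  item 10299 and X.

What this does NOT give (honest gap, see the cell memos MEMO-p3g7-KWPerLowerBound.md and
MEMO-p3g8-KWPer-adversary-calibration.md, and the companion file
`…Theorems.AlgebraicKWGamesLinearFormSearchUpper`): with `Θ(log n)` alternations the budget `(2T+1)^(Δ+2) < n²` is void, and indeed the
cell-identification adversary used here is defeated by an `O(log n)`-round binary-search protocol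
(it is a protocol for the KW game of a LINEAR form, which the adversary cannot tell from `per_n`);
X needs an adversary that sees the permanent.

Honest framing: lower bounds in a toy communication model on a dormant route; VP ≠ VNP is NOT proved
and nothing here is progress on it.
-/

-- the summit and the problem share the name `ValiantsHypothesis` (D-0017 single-conjunct layout)
set_option linter.dupNamespace false

namespace Summit.ValiantsHypothesis.ValiantsHypothesis.Theorems.AlgebraicKWGames

open MvPolynomial OneAlt

/-- The permanent depends on every cell (pointwise): at the all-ones matrix, changing any entry to `2`
changes `per_n`. -/
theorem perPoly_depends_on_every_cell (n : ℕ) (e₀ : Fin n × Fin n) :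
    ∃ a : Fin n × Fin n → ℂ, ∃ w : ℂ,
      eval a (Literature.Computability.AlgebraicComplexity.perPoly (Fin n) ℂ) ≠
        eval (Function.update a e₀ w) (Literature.Computability.AlgebraicComplexity.perPoly (Fin n) ℂ) := by
  refine ⟨fun _ => 1, 2, ?_⟩
  have h : Function.update (fun _ : Fin n × Fin n => (1 : ℂ)) e₀ 2 =
      fun c => if c = e₀ then (2 : ℂ) else 1 := by
    funext c
    by_cases hc : c = e₀
    · subst hc; simp
    · simp [hc]
  rw [h]
  exact perPoly_eval_one_ne e₀

/-- The determinant depends on every cell (pointwise): at the permutation matrix of the transposition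
`(i₀ j₀)`, changing the entry `(i₀, j₀)` to `0` kills `det_n`. -/
theorem detPoly_depends_on_every_cell (n : ℕ) (e₀ : Fin n × Fin n) :
    ∃ a : Fin n × Fin n → ℂ, ∃ w : ℂ,
      eval a (Literature.Computability.AlgebraicComplexity.detPoly (Fin n) ℂ) ≠
        eval (Function.update a e₀ w) (Literature.Computability.AlgebraicComplexity.detPoly (Fin n) ℂ) := by
  obtain ⟨i₀, j₀⟩ := e₀
  set σ : Equiv.Perm (Fin n) := Equiv.swap i₀ j₀ with hσ
  refine ⟨fun c => if σ c.1 = c.2 then 1 else 0, 0, ?_⟩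
  rw [Literature.Computability.AlgebraicComplexity.eval_detPoly,
    Literature.Computability.AlgebraicComplexity.eval_detPoly]
  have h1 : (Matrix.of fun i j : Fin n => (if σ i = j then (1 : ℂ) else 0)) = σ.toPEquiv.toMatrix := by
    ext i j
    simp [PEquiv.toMatrix_apply, Equiv.toPEquiv_apply, eq_comm]
  have h2 : (Matrix.of fun i j : Fin n =>
      Function.update (fun c : Fin n × Fin n => if σ c.1 = c.2 then (1 : ℂ) else 0) (i₀, j₀) 0 (i, j)).det = 0 := by
    refine Matrix.det_eq_zero_of_row_eq_zero i₀ fun j => ?_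
    simp only [Matrix.of_apply]
    by_cases hj : j = j₀
    · subst hj; simp
    · rw [Function.update_of_ne (by simpa using hj)]
      simp [hσ, Equiv.swap_apply_left, Ne.symm hj]
  rw [h1, Matrix.det_permutation, h2]
  simp

/-- **Search with few alternations is expensive, for every polynomial.**  Let `f` be a polynomial in
the `n × n` cells depending on every cell (for every cell some point and some new value of that entry
change `f`), and let `(2T+1)^(Δ+2) + 1 ≤ n²`.  Then there is no zero-test algebraic protocol of depth
`T` — speaker `owner t (z↾t)` chosen by the zero pattern, message a polynomial in the speaker's input
and the earlier messages, output cell chosen by the zero pattern of the `T` messages, as in the crux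
`KWPerLowerBound` — that alternates the speaker at most `Δ` times along every zero pattern and solves
the KW game of `f` (on all inputs with `f a ≠ f b` the output cell `e` has `a e ≠ b e`). -/
theorem kwSearch_lowerBound_of_altBound (n T Δ : ℕ) (f : MvPolynomial (Fin n × Fin n) ℂ)
    (hdep : ∀ e₀ : Fin n × Fin n, ∃ a : Fin n × Fin n → ℂ, ∃ w : ℂ,
      eval a f ≠ eval (Function.update a e₀ w) f)
    (hroom : (2 * T + 1) ^ (Δ + 2) + 1 ≤ n ^ 2) :
    ¬ (∃ (owner : (t : ℕ) → (Fin t → Bool) → Bool)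
        (msg : (t : ℕ) → (Fin t → Bool) → MvPolynomial ((Fin n × Fin n) ⊕ Fin t) ℂ)
        (out : (Fin T → Bool) → Fin n × Fin n),
        (∀ z : ℕ → Bool, ((Finset.range (T - 1)).filter (fun s =>
          owner s (fun j : Fin s => z j) ≠ owner (s + 1) (fun j : Fin (s + 1) => z j))).card ≤ Δ) ∧
        ∀ a b : (Fin n × Fin n) → ℂ, eval a f ≠ eval b f →
          ∀ (m : ℕ → ℂ) (z : ℕ → Bool), (∀ j, z j = true ↔ m j = 0) →
            (∀ t < T, m t = eval (Sum.elim (if owner t (fun j : Fin t => z j) then a else b)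
              (fun j : Fin t => m j)) (msg t (fun j : Fin t => z j))) →
            a (out (fun j : Fin T => z j)) ≠ b (out (fun j : Fin T => z j))) := by
  rintro ⟨owner, msg, out, hΔ, hcorr⟩
  let P : HProtocol n T f :=
    { owner := owner, msg := msg, out := out, dep := hdep, correct := hcorr }
  refine P.false_of_altBound hΔ ?_
  rw [Fintype.card_prod, Fintype.card_fin, ← pow_two]
  exact hroom

/-- **The history-dependent bounded-alternation rung of X (`KWPerLowerBound`), proved.**  For all
`Δ` and `c` there is `n ≥ 2` (namely `n = 2^(2^(2Δ+c+6))`) such that no zero-test algebraic protocol of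
depth `c·(⌊log₂ n⌋+1)²` in the model of the crux — the speaker of round `t` is any function
`owner t (z↾t)` of the zero pattern so far — whose speaker alternates at most `Δ` times along every
zero pattern solves the Karchmer–Wigderson game of `per_n` over `ℂ`.  Dropping the alternation
hypothesis gives exactly `KWPerLowerBound` (see `kwPerLowerBound_implies_altBound`); oblivious
schedules `owner t _ = Even (blk t)` with `blk` monotone `≤ Δ` are the closed item
`BoundedAlternationLowerBound`. -/
theorem kwPer_lowerBound_of_altBound (Δ c : ℕ) : ∃ n : ℕ, 2 ≤ n ∧
    ¬ (∃ (owner : (t : ℕ) → (Fin t → Bool) → Bool)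
        (msg : (t : ℕ) → (Fin t → Bool) → MvPolynomial ((Fin n × Fin n) ⊕ Fin t) ℂ)
        (out : (Fin (c * (Nat.log 2 n + 1) ^ 2) → Bool) → Fin n × Fin n),
        (∀ z : ℕ → Bool, ((Finset.range (c * (Nat.log 2 n + 1) ^ 2 - 1)).filter (fun s =>
          owner s (fun j : Fin s => z j) ≠ owner (s + 1) (fun j : Fin (s + 1) => z j))).card ≤ Δ) ∧
        ∀ a b : (Fin n × Fin n) → ℂ,
          eval a (Literature.Computability.AlgebraicComplexity.perPoly (Fin n) ℂ) ≠
            eval b (Literature.Computability.AlgebraicComplexity.perPoly (Fin n) ℂ) →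
          ∀ (m : ℕ → ℂ) (z : ℕ → Bool), (∀ j, z j = true ↔ m j = 0) →
            (∀ t < c * (Nat.log 2 n + 1) ^ 2, m t = eval
              (Sum.elim (if owner t (fun j : Fin t => z j) then a else b) (fun j : Fin t => m j))
              (msg t (fun j : Fin t => z j))) →
            a (out (fun j : Fin (c * (Nat.log 2 n + 1) ^ 2) => z j)) ≠
              b (out (fun j : Fin (c * (Nat.log 2 n + 1) ^ 2) => z j))) := by
  refine ⟨2 ^ (2 ^ (2 * (Δ + 1) + c + 4)), ?_, ?_⟩
  · calc 2 = 2 ^ 1 := by norm_num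
      _ ≤ 2 ^ (2 ^ (2 * (Δ + 1) + c + 4)) := Nat.pow_le_pow_right (by norm_num) Nat.one_le_two_pow
  · have hlog : Nat.log 2 (2 ^ (2 ^ (2 * (Δ + 1) + c + 4))) = 2 ^ (2 * (Δ + 1) + c + 4) :=
      Nat.log_pow (by norm_num) _
    rintro ⟨owner, msg, out, hΔ, hcorr⟩
    let P : HProtocol (2 ^ (2 ^ (2 * (Δ + 1) + c + 4)))
        (c * (Nat.log 2 (2 ^ (2 ^ (2 * (Δ + 1) + c + 4))) + 1) ^ 2)
        (Literature.Computability.AlgebraicComplexity.perPoly (Fin (2 ^ (2 ^ (2 * (Δ + 1) + c + 4)))) ℂ) :=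
      { owner := owner, msg := msg, out := out, dep := perPoly_depends_on_every_cell _, correct := hcorr }
    refine P.false_of_altBound hΔ ?_
    rw [Fintype.card_prod, Fintype.card_fin, hlog]
    exact budget (Δ + 1) c

/-- **The determinant twin** (the route's remark "expected to hold for `det_n` too — bounded alternation
≠ bounded depth", now checked): the same `n` excludes depth-`c·(⌊log₂ n⌋+1)²` protocols with at most
`Δ` alternations along every zero pattern for the KW game of `det_n`.  So these rungs calibrate the
adversary (search with few alternations), not the permanent-versus-determinant gap. -/
theorem kwDet_lowerBound_of_altBound (Δ c : ℕ) : ∃ n : ℕ, 2 ≤ n ∧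
    ¬ (∃ (owner : (t : ℕ) → (Fin t → Bool) → Bool)
        (msg : (t : ℕ) → (Fin t → Bool) → MvPolynomial ((Fin n × Fin n) ⊕ Fin t) ℂ)
        (out : (Fin (c * (Nat.log 2 n + 1) ^ 2) → Bool) → Fin n × Fin n),
        (∀ z : ℕ → Bool, ((Finset.range (c * (Nat.log 2 n + 1) ^ 2 - 1)).filter (fun s =>
          owner s (fun j : Fin s => z j) ≠ owner (s + 1) (fun j : Fin (s + 1) => z j))).card ≤ Δ) ∧
        ∀ a b : (Fin n × Fin n) → ℂ,
          eval a (Literature.Computability.AlgebraicComplexity.detPoly (Fin n) ℂ) ≠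
            eval b (Literature.Computability.AlgebraicComplexity.detPoly (Fin n) ℂ) →
          ∀ (m : ℕ → ℂ) (z : ℕ → Bool), (∀ j, z j = true ↔ m j = 0) →
            (∀ t < c * (Nat.log 2 n + 1) ^ 2, m t = eval
              (Sum.elim (if owner t (fun j : Fin t => z j) then a else b) (fun j : Fin t => m j))
              (msg t (fun j : Fin t => z j))) →
            a (out (fun j : Fin (c * (Nat.log 2 n + 1) ^ 2) => z j)) ≠
              b (out (fun j : Fin (c * (Nat.log 2 n + 1) ^ 2) => z j))) := by
  refine ⟨2 ^ (2 ^ (2 * (Δ + 1) + c + 4)), ?_, ?_⟩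
  · calc 2 = 2 ^ 1 := by norm_num
      _ ≤ 2 ^ (2 ^ (2 * (Δ + 1) + c + 4)) := Nat.pow_le_pow_right (by norm_num) Nat.one_le_two_pow
  · have hlog : Nat.log 2 (2 ^ (2 ^ (2 * (Δ + 1) + c + 4))) = 2 ^ (2 * (Δ + 1) + c + 4) :=
      Nat.log_pow (by norm_num) _
    rintro ⟨owner, msg, out, hΔ, hcorr⟩
    let P : HProtocol (2 ^ (2 ^ (2 * (Δ + 1) + c + 4)))
        (c * (Nat.log 2 (2 ^ (2 ^ (2 * (Δ + 1) + c + 4))) + 1) ^ 2)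
        (Literature.Computability.AlgebraicComplexity.detPoly (Fin (2 ^ (2 ^ (2 * (Δ + 1) + c + 4)))) ℂ) :=
      { owner := owner, msg := msg, out := out, dep := detPoly_depends_on_every_cell _, correct := hcorr }
    refine P.false_of_altBound hΔ ?_
    rw [Fintype.card_prod, Fintype.card_fin, hlog]
    exact budget (Δ + 1) c

/-- **The sandwich, upper half.**  The crux `KWPerLowerBound` implies the history-dependent
bounded-alternation statement `kwPer_lowerBound_of_altBound` for every `Δ` (drop the alternation
hypothesis); the lower half — it implies the oblivious item `BoundedAlternationLowerBound` — is the
planner's remark in the route file.  Recorded so that the position of the new rung is checked by the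
kernel. -/
theorem kwPerLowerBound_implies_altBound
    (hX : Summit.ValiantsHypothesis.ValiantsHypothesis.Theses.AlgebraicKWGames.KWPerLowerBound)
    (Δ c : ℕ) : ∃ n : ℕ, 2 ≤ n ∧
    ¬ (∃ (owner : (t : ℕ) → (Fin t → Bool) → Bool)
        (msg : (t : ℕ) → (Fin t → Bool) → MvPolynomial ((Fin n × Fin n) ⊕ Fin t) ℂ)
        (out : (Fin (c * (Nat.log 2 n + 1) ^ 2) → Bool) → Fin n × Fin n),
        (∀ z : ℕ → Bool, ((Finset.range (c * (Nat.log 2 n + 1) ^ 2 - 1)).filter (fun s =>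
          owner s (fun j : Fin s => z j) ≠ owner (s + 1) (fun j : Fin (s + 1) => z j))).card ≤ Δ) ∧
        ∀ a b : (Fin n × Fin n) → ℂ,
          eval a (Literature.Computability.AlgebraicComplexity.perPoly (Fin n) ℂ) ≠
            eval b (Literature.Computability.AlgebraicComplexity.perPoly (Fin n) ℂ) →
          ∀ (m : ℕ → ℂ) (z : ℕ → Bool), (∀ j, z j = true ↔ m j = 0) →
            (∀ t < c * (Nat.log 2 n + 1) ^ 2, m t = eval
              (Sum.elim (if owner t (fun j : Fin t => z j) then a else b) (fun j : Fin t => m j))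
              (msg t (fun j : Fin t => z j))) →
            a (out (fun j : Fin (c * (Nat.log 2 n + 1) ^ 2) => z j)) ≠
              b (out (fun j : Fin (c * (Nat.log 2 n + 1) ^ 2) => z j))) := by
  obtain ⟨n, hn, hno⟩ := hX c
  refine ⟨n, hn, ?_⟩
  rintro ⟨owner, msg, out, -, hcorr⟩
  exact hno ⟨owner, msg, out, hcorr⟩

/-- Parity changes of a monotone sequence bounded by `Δ` happen at most `Δ` times. -/
theorem card_parity_changes_le {blk : ℕ → ℕ} (hmono : Monotone blk) {Δ : ℕ} (hΔ : ∀ t, blk t ≤ Δ)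
    (N : ℕ) : ((Finset.range N).filter (fun s => decide (Even (blk s)) ≠ decide (Even (blk (s + 1))))).card ≤ Δ := by
  calc ((Finset.range N).filter (fun s => decide (Even (blk s)) ≠ decide (Even (blk (s + 1))))).card
      = ∑ s ∈ Finset.range N, (if decide (Even (blk s)) ≠ decide (Even (blk (s + 1))) then 1 else 0) :=
        Finset.card_filter _ _
    _ ≤ ∑ s ∈ Finset.range N, (blk (s + 1) - blk s) := by
        refine Finset.sum_le_sum fun s _ => ?_
        split_ifs with h
        · have hne : blk s ≠ blk (s + 1) := fun heq => h (by rw [heq])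
          have hle : blk s ≤ blk (s + 1) := hmono (Nat.le_succ s)
          omega
        · exact Nat.zero_le _
    _ = blk N - blk 0 := Finset.sum_range_tsub hmono N
    _ ≤ Δ := (Nat.sub_le _ _).trans (hΔ N)

/-- **The sandwich, lower half** (pointwise in `n` and the depth `T`): the history-dependent
bounded-alternation statement implies the oblivious one of item 10299 — an oblivious monotone block
schedule `blk ≤ Δ` is the history-dependent schedule `owner t _ = Even (blk t)`, which alternates at
most `Δ` times along every zero pattern (`card_parity_changes_le`).  With `kwPer_lowerBound_of_altBound`
this re-proves the closed item 10299 (`BoundedAlternationLowerBound`, `boundedAlternationLowerBound_proof`),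
completing the kernel form of "10299 ⇐ new rung ⇐ X". -/
theorem oblivious_of_altBound (n T Δ : ℕ) (f : MvPolynomial (Fin n × Fin n) ℂ)
    (h : ¬ (∃ (owner : (t : ℕ) → (Fin t → Bool) → Bool)
        (msg : (t : ℕ) → (Fin t → Bool) → MvPolynomial ((Fin n × Fin n) ⊕ Fin t) ℂ)
        (out : (Fin T → Bool) → Fin n × Fin n),
        (∀ z : ℕ → Bool, ((Finset.range (T - 1)).filter (fun s =>
          owner s (fun j : Fin s => z j) ≠ owner (s + 1) (fun j : Fin (s + 1) => z j))).card ≤ Δ) ∧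
        ∀ a b : (Fin n × Fin n) → ℂ, eval a f ≠ eval b f →
          ∀ (m : ℕ → ℂ) (z : ℕ → Bool), (∀ j, z j = true ↔ m j = 0) →
            (∀ t < T, m t = eval (Sum.elim (if owner t (fun j : Fin t => z j) then a else b)
              (fun j : Fin t => m j)) (msg t (fun j : Fin t => z j))) →
            a (out (fun j : Fin T => z j)) ≠ b (out (fun j : Fin T => z j)))) :
    ¬ (∃ (blk : ℕ → ℕ) (msg : (t : ℕ) → (Fin t → Bool) → MvPolynomial ((Fin n × Fin n) ⊕ Fin t) ℂ)
        (out : (Fin T → Bool) → Fin n × Fin n), Monotone blk ∧ (∀ t, blk t ≤ Δ) ∧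
        ∀ a b : (Fin n × Fin n) → ℂ, eval a f ≠ eval b f →
          ∀ (m : ℕ → ℂ) (z : ℕ → Bool), (∀ j, z j = true ↔ m j = 0) →
            (∀ t < T, m t = eval (Sum.elim (if Even (blk t) then a else b) (fun j : Fin t => m j))
              (msg t (fun j : Fin t => z j))) →
            a (out (fun j : Fin T => z j)) ≠ b (out (fun j : Fin T => z j))) := by
  rintro ⟨blk, msg, out, hmono, hΔ, hcorr⟩
  apply h
  refine ⟨fun t _ => decide (Even (blk t)), msg, out, fun z => card_parity_changes_le hmono hΔ _, ?_⟩
  intro a b hab m z hz hm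
  refine hcorr a b hab m z hz fun t ht => ?_
  rw [hm t ht]
  simp only [decide_eq_true_eq]

/-! ## The rung for all large `n` (appended) -/

/-- Polynomial versus exponential: for all large `L`, `C·(L+1)^k + 1 ≤ 4^L`. -/
theorem poly_le_four_pow_eventually (C k : ℕ) : ∃ L₀ : ℕ, ∀ L, L₀ ≤ L → C * (L + 1) ^ k + 1 ≤ 4 ^ L := by
  have ht := tendsto_pow_const_div_const_pow_of_one_lt k (by norm_num : (1 : ℝ) < 4)
  have hε : (0 : ℝ) < 1 / (4 * ((C : ℝ) + 1)) := by positivity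
  obtain ⟨M, hM⟩ := Filter.eventually_atTop.mp (ht.eventually (gt_mem_nhds hε))
  refine ⟨M, fun L hL => ?_⟩
  have h1 := hM (L + 1) (by omega)
  have h4 : (0 : ℝ) < 4 ^ (L + 1) := by positivity
  rw [div_lt_iff₀ h4] at h1
  -- `h1 : ↑(L+1)^k < 1/(4(C+1)) * 4^(L+1)`, i.e. `(C+1) (L+1)^k < 4^L`
  have hC : (0 : ℝ) < (C : ℝ) + 1 := by positivity
  have h2 : ((C : ℝ) + 1) * ((L + 1 : ℕ) : ℝ) ^ k < (4 : ℝ) ^ L := by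
    have := mul_lt_mul_of_pos_left h1 hC
    have h3 : ((C : ℝ) + 1) * (1 / (4 * ((C : ℝ) + 1)) * (4 : ℝ) ^ (L + 1)) = (4 : ℝ) ^ L := by
      field_simp
      ring
    linarith [h3]
  have h5 : (1 : ℝ) ≤ ((L + 1 : ℕ) : ℝ) ^ k := by
    exact one_le_pow₀ (by exact_mod_cast Nat.succ_le_succ (Nat.zero_le L))
  have h6 : ((C : ℝ) * ((L + 1 : ℕ) : ℝ) ^ k + 1) ≤ (4 : ℝ) ^ L := by nlinarith
  exact_mod_cast h6

/-- The depth budget for all large `n`: eventually `(2T+1)^(Δ+2) + 1 ≤ n²` for `T = c·(⌊log₂ n⌋+1)²`. -/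
theorem budget_eventually (Δ c : ℕ) : ∃ n₀ : ℕ, 2 ≤ n₀ ∧ ∀ n, n₀ ≤ n →
    (2 * (c * (Nat.log 2 n + 1) ^ 2) + 1) ^ (Δ + 2) + 1 ≤ n * n := by
  obtain ⟨L₀, hL₀⟩ := poly_le_four_pow_eventually ((2 * c + 1) ^ (Δ + 2)) (2 * (Δ + 2))
  refine ⟨max 2 (2 ^ L₀), le_max_left _ _, fun n hn => ?_⟩
  have hn2 : 2 ≤ n := le_trans (le_max_left _ _) hn
  have hn0 : n ≠ 0 := by omega
  set L := Nat.log 2 n with hL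
  have hLL : L₀ ≤ L := Nat.le_log_of_pow_le (by norm_num) (le_trans (le_max_right _ _) hn)
  have hpow : 2 ^ L ≤ n := Nat.pow_log_le_self 2 hn0
  have h1 : 2 * (c * (L + 1) ^ 2) + 1 ≤ (2 * c + 1) * (L + 1) ^ 2 := by
    have : 1 ≤ (L + 1) ^ 2 := Nat.one_le_pow _ _ (Nat.succ_pos L)
    nlinarith
  have h2 : (2 * (c * (L + 1) ^ 2) + 1) ^ (Δ + 2) ≤ (2 * c + 1) ^ (Δ + 2) * (L + 1) ^ (2 * (Δ + 2)) := by
    calc (2 * (c * (L + 1) ^ 2) + 1) ^ (Δ + 2) ≤ ((2 * c + 1) * (L + 1) ^ 2) ^ (Δ + 2) :=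
          Nat.pow_le_pow_left h1 _
      _ = (2 * c + 1) ^ (Δ + 2) * (L + 1) ^ (2 * (Δ + 2)) := by rw [mul_pow, ← pow_mul]
  have h3 := hL₀ L hLL
  have h4 : 4 ^ L = 2 ^ L * 2 ^ L := by
    rw [show (4 : ℕ) = 2 * 2 by norm_num, mul_pow]
  calc (2 * (c * (L + 1) ^ 2) + 1) ^ (Δ + 2) + 1
      ≤ (2 * c + 1) ^ (Δ + 2) * (L + 1) ^ (2 * (Δ + 2)) + 1 := Nat.add_le_add_right h2 1
    _ ≤ 4 ^ L := h3
    _ = 2 ^ L * 2 ^ L := h4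
    _ ≤ n * n := Nat.mul_le_mul hpow hpow

/-- **The history-dependent bounded-alternation rung, for ALL large `n`** (strengthening the `∃ n` of
`kwPer_lowerBound_of_altBound` to an eventual statement, which is the natural shape of a lower
bound): for all `Δ, c` there is `n₀` such that for every `n ≥ n₀` no zero-test algebraic protocol of
depth `c·(⌊log₂ n⌋+1)²` in the model of `KWPerLowerBound` whose speaker alternates at most `Δ` times
along every zero pattern solves the KW game of `per_n`. -/
theorem kwPer_lowerBound_of_altBound_eventually (Δ c : ℕ) : ∃ n₀ : ℕ, ∀ n, n₀ ≤ n →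
    ¬ (∃ (owner : (t : ℕ) → (Fin t → Bool) → Bool)
        (msg : (t : ℕ) → (Fin t → Bool) → MvPolynomial ((Fin n × Fin n) ⊕ Fin t) ℂ)
        (out : (Fin (c * (Nat.log 2 n + 1) ^ 2) → Bool) → Fin n × Fin n),
        (∀ z : ℕ → Bool, ((Finset.range (c * (Nat.log 2 n + 1) ^ 2 - 1)).filter (fun s =>
          owner s (fun j : Fin s => z j) ≠ owner (s + 1) (fun j : Fin (s + 1) => z j))).card ≤ Δ) ∧
        ∀ a b : (Fin n × Fin n) → ℂ,
          eval a (Literature.Computability.AlgebraicComplexity.perPoly (Fin n) ℂ) ≠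
            eval b (Literature.Computability.AlgebraicComplexity.perPoly (Fin n) ℂ) →
          ∀ (m : ℕ → ℂ) (z : ℕ → Bool), (∀ j, z j = true ↔ m j = 0) →
            (∀ t < c * (Nat.log 2 n + 1) ^ 2, m t = eval
              (Sum.elim (if owner t (fun j : Fin t => z j) then a else b) (fun j : Fin t => m j))
              (msg t (fun j : Fin t => z j))) →
            a (out (fun j : Fin (c * (Nat.log 2 n + 1) ^ 2) => z j)) ≠
              b (out (fun j : Fin (c * (Nat.log 2 n + 1) ^ 2) => z j))) := by
  obtain ⟨n₀, -, hn₀⟩ := budget_eventually Δ c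
  refine ⟨n₀, fun n hn => ?_⟩
  apply kwSearch_lowerBound_of_altBound n (c * (Nat.log 2 n + 1) ^ 2) Δ _
    (perPoly_depends_on_every_cell n)
  rw [show n ^ 2 = n * n from pow_two n]
  exact hn₀ n hn

end Summit.ValiantsHypothesis.ValiantsHypothesis.Theorems.AlgebraicKWGames
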